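import Summits.Ventures.YMGap.RobustBall.LangevinPoincareDLR
import Summits.Ventures.YMGap.Thresholds.SharpLargeN
import Summits.Ventures.YMGap.Thresholds.LatticeBakryEmeryLipschitz
import Literature.MathematicalPhysics.QuantumFieldTheory.Balaban1983to89.StrongCouplingKernelWindow
import HarnessLib

/-!
# Robust ball (Y2) — THE LIPSCHITZ CLAUSE OF THE GIBBS-STATE LANGEVIN POINCARÉ INEQUALITY AND THE `O(1/N²)` ('T HOOFT-SCALING) VARIANCE OF THE
# PLAQUETTE IN EVERY DLR STATE

HONEST FRAMING: venture file of the cell `pub-ymgap` (QuantumFields programme), track ROBUST-BALL, seat rb-p2 (g16); a corollary of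
`LangevinPoincareDLR.gibbs_variance_le_integral_Gam_of_oneLinkKRModulus` (g14: the gradient-form Poincaré inequality of EVERY DLR state of the Wilson
specification of `SU(N)` lattice Yang–Mills on `ℤ^d`, Kantorovich–Rubinstein window) and of the frame bound `Γ(u,u) ≤ ∑_e L_e²`
(`LatticeBakryEmery.Gam_le_of_linkLipschitz`).  LATTICE statements at STRONG COUPLING, Wilson action (class K); nothing about `β → ∞`, the continuum or Clay.

THE STATEMENTS ('t Hooft coupling `β`, bare `Nβ`; `2(d−1)|β| ≤ R`, `OneLinkKRModulus N R K`, `c := 6(d−1)|β|K < 1`, `K₀ := N/2 − 2(d−1)N|β| > 0`; `μ` ANY DLR state):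
* ★ `gibbs_variance_le_sum_sq_of_oneLinkKRModulus` — THE LIPSCHITZ CLAUSE: for every smooth `f` of the link matrices over a finite `Δ` which is `L_e`-Lipschitz in the
  link `e` (Frobenius distance; tree predicate `LinkLipschitz f L`), `Var_μ(f((U_e)_{e∈Δ})) ≤ ((1 − c)K₀)⁻¹ ∑_e L_e²` (the torus / limit-state clauses are in
  `LangevinPoincareCells`; this is the every-DLR-state one, no uniqueness input).  `SU(2)`, `d = 4`, `0 ≤ β_W < 2/9`: `((1 − 9β_W/2)(1 − 3β_W))⁻¹ ∑_e L_e²`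
  (`su2_gibbs_variance_le_sum_sq`).
* ★ `plaqFun_linkLipschitz` — the normalised plaquette `W_p = (1/N) Re tr U_p` (`HessianSharp.plaqFun`) is `(√N)⁻¹`-Lipschitz in EACH of its four links (the tree's
  `plaqFun_lipschitz` states `4/√N`; the four links are distinct, `pe_pairwise_ne`, so the telescoping sum `plaqFun_sub_le` has one non-zero term); on a larger link
  set the constant at `e` is `(√N)⁻¹·[e ∈ plaquetteEdges p]` (`abs_plaqFun_sub_le_ite`, the input of the smeared-field file).
* ★★ `gibbs_variance_plaquette_le_of_oneLinkKRModulus`: `Var_μ(W_p) ≤ ((1 − c)K₀)⁻¹ · 4/N` for EVERY DLR state — `O(1/N²)` at fixed 't Hooft coupling, the shape of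
  Shen–Zhu–Zhu's Cor. 1.5 (there: the infinite-volume limit state, Bakry–Émery window `1/(16(d−1))`; tree `SharpLargeNFree`: limit points, `|β| < 1/(8d)`, constant
  `128/(N²(1 − 8d|β|))`), here on the KR window and for every Gibbs state: ★ `suN_gibbs_variance_plaquette_le_bakryEmery` — every `N ≥ 2`, `d = 4`, `0 ≤ b < 1/48`:
  `Var_μ(W_p) ≤ 4/(N²(1/2 − 24b))`; ★ `su2_gibbs_variance_plaquette_le` — `SU(2)`, `d = 4`, `0 ≤ β_W < 2/9`: `Var_μ(W_p) ≤ 2/((1 − 9β_W/2)(1 − 3β_W))` (the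
  oscillation route of `PlaquetteCovarianceForm` gives `96/(2 − 9β_W)`; Haar value at `β_W = 0`: `1/4`).
MECHANISM: `Γ(f,f) ≤ ∑_e L_e²` pointwise on `SU(N)^Δ` (frame trick) integrated against the probability measure `μ`; `|Δ_e W_p| ≤ (√N)⁻¹ ‖U_e − U'_e‖_F`
(telescoping + unitary invariance of the Hilbert–Schmidt norm); `#plaquetteEdges p ≤ 4`.  0 sorry, 0 definitions.  References: H. Shen, R. Zhu, X. Zhu, CMP 400 (2023)
805–851, Cor. 1.5, Rem. 1.3; D. W. Stroock, B. Zegarlinski, CMP 144 (1992) 303–323.  Everything here is proved. [folklore]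
-/

noncomputable section

open scoped Matrix ComplexConjugate BigOperators Matrix.Norms.Frobenius ContDiff Topology ProbabilityTheory NNReal
open Matrix Complex Finset MeasureTheory Filter ProbabilityTheory Function Real
open Literature.Probability.LatticeModels Literature.Probability.LatticeModels.DobrushinMetric
open Literature.MathematicalPhysics.QuantumLattice hiding torusNorm
open Literature.MathematicalPhysics.QuantumFieldTheory hiding ZdEdge
open Literature.MathematicalPhysics.QuantumFieldTheory.SUNBakryEmery (SUN FrameIdx frame)
open Literature.MathematicalPhysics.QuantumFieldTheory.Balaban1983to89.StrongCouplingDobrushinWindow (OneLinkKRModulus)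
open Summit.Ventures.YMGap.LatticeBakryEmery
open Summit.Ventures.YMGap.HessianSharp (plaqFun pe₁ pe₂ pe₃ pe₄ plaqFun_sub_le contDiff_plaqFun matrixCylinder_plaqFun)

namespace Summit.Ventures.YMGap.RobustBall.LangevinPoincare

variable {d N : ℕ}

/-! ### The Lipschitz clause of the Gibbs-state Langevin Poincaré inequality -/

section Clause

/-- ★ **THE LIPSCHITZ CLAUSE OF THE GIBBS-STATE LANGEVIN POINCARÉ INEQUALITY** (`SU(N)` lattice Yang–Mills on `ℤ^d`, 't Hooft coupling `β`, bare `Nβ`):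
if `2(d−1)|β| ≤ R`, `OneLinkKRModulus N R K` (`K ≥ 0`), `6(d−1)|β|K ≤ c < 1` and `K₀ := N/2 − N|β|·2(d−1) > 0`, then for EVERY DLR state `μ`, every finite link
set `Δ` and every smooth `f` of the link matrices over `Δ` which is `L_e`-Lipschitz in the link `e` for the Frobenius distance (`LinkLipschitz f L`, `L ≥ 0`),
`Var_μ(f((U_e)_{e∈Δ})) ≤ ((1 − c)K₀)⁻¹ ∑_{e∈Δ} L_e²`. [folklore] -/
theorem gibbs_variance_le_sum_sq_of_oneLinkKRModulus (hd : 1 ≤ d) (hN : 1 ≤ N) {β R K c : ℝ} (hK : 0 ≤ K)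
    (hR : |β| * (2 * ((d : ℝ) - 1)) ≤ R) (hmod : OneLinkKRModulus N R K) (hc : 6 * ((d : ℝ) - 1) * |β| * K ≤ c) (hc1 : c < 1)
    (hK₀ : 0 < (N : ℝ) / 2 - N * |β| * (2 * ((d : ℝ) - 1)))
    {μ : Measure (LGConfig d (SUN N))} (hμ : μ ∈ ymGibbsMeasures (d := d) (fundamentalRep (Fin N)) ((N : ℝ) * β))
    (Δ : Finset (ZdEdge d)) {f : Cfg ↥Δ N → ℝ} (hf : ContDiff ℝ ∞ f) {L : ↥Δ → ℝ} (hL : ∀ e, 0 ≤ L e) (hLip : LinkLipschitz f L) :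
    Var[matrixCylinder Δ f; μ] ≤ ((1 - c) * ((N : ℝ) / 2 - N * |β| * (2 * ((d : ℝ) - 1))))⁻¹ * ∑ e, L e ^ 2 := by
  have hN0 : N ≠ 0 := by omega
  have hμ' : IsGibbsMeasure (ymSpecification (d := d) (fundamentalRep (Fin N)) ((N : ℝ) * β)) μ := hμ
  haveI := hμ'.isProbabilityMeasure
  have key := gibbs_variance_le_integral_Gam_of_oneLinkKRModulus hd hN hK hR hmod hc hc1 hK₀ hμ Δ hf
  -- `Γ(f,f) ≤ ∑_e L_e²` pointwise on `SU(N)^Δ`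
  have hpt : ∀ U : LGConfig d (SUN N), Gam f f (fun e : ↥Δ => (U e : Matrix (Fin N) (Fin N) ℂ)) ≤ ∑ e, L e ^ 2 :=
    fun U => Gam_le_of_linkLipschitz hN0 hf hL hLip (fun e : ↥Δ => U e)
  have hint : ∫ U, Gam f f (fun e : ↥Δ => (U e : Matrix (Fin N) (Fin N) ℂ)) ∂μ ≤ ∑ e, L e ^ 2 := by
    calc ∫ U, Gam f f (fun e : ↥Δ => (U e : Matrix (Fin N) (Fin N) ℂ)) ∂μ ≤ ∫ _U, (∑ e, L e ^ 2) ∂μ :=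
          integral_mono_of_nonneg (ae_of_all _ fun U => Gam_self_nonneg _ _) (integrable_const _) (ae_of_all _ hpt)
      _ = ∑ e, L e ^ 2 := by simp
  have hA : 0 ≤ ((1 - c) * ((N : ℝ) / 2 - N * |β| * (2 * ((d : ℝ) - 1))))⁻¹ := inv_nonneg.2 (mul_pos (by linarith) hK₀).le
  exact key.trans (mul_le_mul_of_nonneg_left hint hA)

/-- **`SU(2)`, `d = 4`, HYPOTHESIS-FREE on `0 ≤ β_W < 2/9`** (tree coupling `β_W/2`, quarter modulus): for EVERY DLR state `μ`, every finite `Δ` and every smooth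
`f` over `Δ` with `LinkLipschitz f L`, `Var_μ(f((U_e)_{e∈Δ})) ≤ ((1 − 9β_W/2)(1 − 3β_W))⁻¹ ∑_e L_e²`. [folklore] -/
theorem su2_gibbs_variance_le_sum_sq {βW : ℝ} (h0 : 0 ≤ βW) (h : βW < 2 / 9)
    {μ : Measure (LGConfig 4 (SUN 2))} (hμ : μ ∈ ymGibbsMeasures (d := 4) (fundamentalRep (Fin 2)) (βW / 2))
    (Δ : Finset (ZdEdge 4)) {f : Cfg ↥Δ 2 → ℝ} (hf : ContDiff ℝ ∞ f) {L : ↥Δ → ℝ} (hL : ∀ e, 0 ≤ L e) (hLip : LinkLipschitz f L) :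
    Var[matrixCylinder Δ f; μ] ≤ ((1 - 9 * βW / 2) * (1 - 3 * βW))⁻¹ * ∑ e, L e ^ 2 := by
  have hβ : ((2 : ℕ) : ℝ) * (βW / 4) = βW / 2 := by push_cast; ring
  have habs : |βW / 4| = βW / 4 := abs_of_nonneg (by positivity)
  have hμ4 : μ ∈ ymGibbsMeasures (d := 4) (fundamentalRep (Fin 2)) (((2 : ℕ) : ℝ) * (βW / 4)) := by rwa [hβ]
  have key := gibbs_variance_le_sum_sq_of_oneLinkKRModulus (d := 4) (N := 2) (by norm_num) (by norm_num) (β := βW / 4) zero_le_one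
    (R := 3 * βW / 2) (by rw [habs]; norm_num; linarith) (SlabAreaLawDimensions.su2_oneLinkKRModulus_of_le_one (by linarith))
    (c := 9 * βW / 2) (by rw [habs]; norm_num; linarith) (by linarith) (by rw [habs]; norm_num; linarith) hμ4 Δ hf hL hLip
  have e : (1 - 9 * βW / 2) * (((2 : ℕ) : ℝ) / 2 - (2 : ℕ) * |βW / 4| * (2 * (((4 : ℕ) : ℝ) - 1))) = (1 - 9 * βW / 2) * (1 - 3 * βW) := by
    rw [habs]; push_cast; ring
  rw [e] at key
  exact key

end Clause

/-! ### The plaquette: per-link Lipschitz constant `(√N)⁻¹` and the `O(1/N²)` variance bound -/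

section Plaquette

/-- The four links of a plaquette are pairwise distinct (directions `i < j`, base points `x ≠ x + e_k`): stated as the six inequalities between the named links
`pe₁ … pe₄` of `SharpLargeN`. [folklore] -/
theorem pe_pairwise_ne (p : ZdPlaquette d) :
    ((pe₁ p : ZdEdge d) ≠ pe₂ p ∧ (pe₁ p : ZdEdge d) ≠ pe₃ p ∧ (pe₁ p : ZdEdge d) ≠ pe₄ p) ∧
      ((pe₂ p : ZdEdge d) ≠ pe₃ p ∧ (pe₂ p : ZdEdge d) ≠ pe₄ p ∧ (pe₃ p : ZdEdge d) ≠ pe₄ p) := by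
  obtain ⟨x, ⟨⟨i, j⟩, hij⟩⟩ := p
  have hij' : i ≠ j := ne_of_lt hij
  have hi : x ≠ x + Pi.single i 1 := fun h => by have := congrFun h i; simp at this
  have hj : x ≠ x + Pi.single j 1 := fun h => by have := congrFun h j; simp at this
  simp only [pe₁, pe₂, pe₃, pe₄, ne_eq, Prod.mk.injEq, not_and]
  exact ⟨⟨fun _ => hij', fun h => absurd h hj, fun _ => hij'⟩, ⟨fun _ h => hij' h.symm, fun h => absurd h.symm hi, fun _ => hij'⟩⟩

/-- At most one of the four links of a plaquette is a given link `e`, and only if `e ∈ plaquetteEdges p`: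
`∑_{k=1}^{4} [pe_k = e]·D ≤ [e ∈ plaquetteEdges p]·D` (indeed with equality). [folklore] -/
theorem sum_four_ite_le (p : ZdPlaquette d) (e : ZdEdge d) (D : ℝ) :
    (if (pe₁ p : ZdEdge d) = e then D else 0) + (if (pe₂ p : ZdEdge d) = e then D else 0) +
        (if (pe₃ p : ZdEdge d) = e then D else 0) + (if (pe₄ p : ZdEdge d) = e then D else 0) ≤
      if e ∈ plaquetteEdges p then D else 0 := by
  obtain ⟨⟨h12, h13, h14⟩, ⟨h23, h24, h34⟩⟩ := pe_pairwise_ne p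
  by_cases he : e ∈ plaquetteEdges p
  · rw [if_pos he]
    have he' : e = pe₁ p ∨ e = pe₂ p ∨ e = pe₃ p ∨ e = pe₄ p := by
      simpa [plaquetteEdges, pe₁, pe₂, pe₃, pe₄] using he
    rcases he' with rfl | rfl | rfl | rfl
    · rw [if_pos rfl, if_neg h12.symm, if_neg h13.symm, if_neg h14.symm]; linarith
    · rw [if_neg h12, if_pos rfl, if_neg h23.symm, if_neg h24.symm]; linarith
    · rw [if_neg h13, if_neg h23, if_pos rfl, if_neg h34.symm]; linarith
    · rw [if_neg h14, if_neg h24, if_neg h34, if_pos rfl]; linarith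
  · have h1 : (pe₁ p : ZdEdge d) ≠ e := fun h => he (h ▸ (pe₁ p).2)
    have h2 : (pe₂ p : ZdEdge d) ≠ e := fun h => he (h ▸ (pe₂ p).2)
    have h3 : (pe₃ p : ZdEdge d) ≠ e := fun h => he (h ▸ (pe₃ p).2)
    have h4 : (pe₄ p : ZdEdge d) ≠ e := fun h => he (h ▸ (pe₄ p).2)
    rw [if_neg he, if_neg h1, if_neg h2, if_neg h3, if_neg h4]; linarith

/-- **The plaquette on a larger link set is `(√N)⁻¹·[e ∈ p]`-Lipschitz in the link `e`**: if `plaquetteEdges p ⊆ Λ` (inclusion `ι`) and two `SU(N)` link families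
over `Λ` agree off `e₀`, then `|W_p(M) − W_p(M')| ≤ (√N)⁻¹ · [e₀ ∈ plaquetteEdges p] · ‖M_{e₀} − M'_{e₀}‖_F`. [folklore] -/
theorem abs_plaqFun_sub_le_ite (hN : 1 ≤ N) (p : ZdPlaquette d) {Λ : Finset (ZdEdge d)} (hp : plaquetteEdges p ⊆ Λ)
    (e₀ : ↥Λ) (M M' : ↥Λ → SUN N) (h : ∀ e', e' ≠ e₀ → M e' = M' e') :
    |plaqFun p (fun e => (M ⟨e, hp e.2⟩ : Matrix (Fin N) (Fin N) ℂ)) - plaqFun p (fun e => (M' ⟨e, hp e.2⟩ : Matrix (Fin N) (Fin N) ℂ))| ≤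
      (Real.sqrt N)⁻¹ * (if (e₀ : ZdEdge d) ∈ plaquetteEdges p then suFrobDist (M e₀) (M' e₀) else 0) := by
  have h1 := plaqFun_sub_le p (fun e => M ⟨e, hp e.2⟩) (fun e => M' ⟨e, hp e.2⟩) hN
  -- each of the four link distances is `D` if that link is `e₀` and `0` otherwise
  have hk : ∀ x : ↥(plaquetteEdges p), suFrobDist (M ⟨x, hp x.2⟩) (M' ⟨x, hp x.2⟩) ≤
      if (x : ZdEdge d) = e₀ then suFrobDist (M e₀) (M' e₀) else 0 := by
    intro x
    split_ifs with hx
    · have : (⟨(x : ZdEdge d), hp x.2⟩ : ↥Λ) = e₀ := Subtype.ext hx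
      rw [this]
    · rw [h _ (fun h' => hx (congrArg Subtype.val h')), suFrobDist_self]
  have hs : 0 ≤ (Real.sqrt N)⁻¹ := inv_nonneg.2 (Real.sqrt_nonneg _)
  refine h1.trans (mul_le_mul_of_nonneg_left ?_ hs)
  refine le_trans ?_ (sum_four_ite_le p (e₀ : ZdEdge d) (suFrobDist (M e₀) (M' e₀)))
  linarith [hk (pe₁ p), hk (pe₂ p), hk (pe₃ p), hk (pe₄ p)]

/-- ★ **The normalised plaquette `W_p = (1/N) Re tr U_p` is `(√N)⁻¹`-Lipschitz in each of its four links** (Frobenius distance; the tree's `plaqFun_lipschitz` has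
`4/√N`): `LinkLipschitz (plaqFun p) (fun _ => (√N)⁻¹)`. [folklore] -/
theorem plaqFun_linkLipschitz (hN : 1 ≤ N) (p : ZdPlaquette d) :
    LinkLipschitz (plaqFun (N := N) p) (fun _ => (Real.sqrt N)⁻¹) := by
  intro e₀ M M' h
  have h1 := abs_plaqFun_sub_le_ite hN p (subset_refl _) e₀ M M' h
  rw [if_pos e₀.2] at h1
  exact h1

/-- Dictionary: the cylinder function `plaqFun p` on `SU(N)` configurations is the tree's normalised plaquette observable `zdPlaquetteObs` (`W_p = (1/N) Re tr U_p`).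
[folklore] -/
theorem matrixCylinder_plaqFun_eq_zdPlaquetteObs (p : ZdPlaquette d) (U : LGConfig d (SUN N)) :
    matrixCylinder (plaquetteEdges p) (plaqFun p) U = zdPlaquetteObs (d := d) (fundamentalRep (Fin N)) p.1 p.2.1.1 p.2.1.2 U := by
  rw [matrixCylinder_plaqFun]
  rfl

/-- ★ **`Var_μ(W_p) ≤ ((1 − c)K₀)⁻¹ · 4/N` IN EVERY GIBBS STATE** (every `SU(N)`, `d ≥ 1`, KR window) — `O(1/N²)` at fixed 't Hooft coupling. [folklore] -/
theorem gibbs_variance_plaquette_le_of_oneLinkKRModulus (hd : 1 ≤ d) (hN : 1 ≤ N) {β R K c : ℝ} (hK : 0 ≤ K)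
    (hR : |β| * (2 * ((d : ℝ) - 1)) ≤ R) (hmod : OneLinkKRModulus N R K) (hc : 6 * ((d : ℝ) - 1) * |β| * K ≤ c) (hc1 : c < 1)
    (hK₀ : 0 < (N : ℝ) / 2 - N * |β| * (2 * ((d : ℝ) - 1)))
    {μ : Measure (LGConfig d (SUN N))} (hμ : μ ∈ ymGibbsMeasures (d := d) (fundamentalRep (Fin N)) ((N : ℝ) * β)) (p : ZdPlaquette d) :
    Var[zdPlaquetteObs (d := d) (fundamentalRep (Fin N)) p.1 p.2.1.1 p.2.1.2; μ] ≤
      ((1 - c) * ((N : ℝ) / 2 - N * |β| * (2 * ((d : ℝ) - 1))))⁻¹ * (4 / N) := by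
  have hN0 : (0 : ℝ) < N := by exact_mod_cast hN
  have key := gibbs_variance_le_sum_sq_of_oneLinkKRModulus hd hN hK hR hmod hc hc1 hK₀ hμ (plaquetteEdges p) (contDiff_plaqFun p)
    (fun _ => inv_nonneg.2 (Real.sqrt_nonneg _)) (plaqFun_linkLipschitz hN p)
  have hfun : matrixCylinder (plaquetteEdges p) (plaqFun (N := N) p) = zdPlaquetteObs (d := d) (fundamentalRep (Fin N)) p.1 p.2.1.1 p.2.1.2 :=
    funext (matrixCylinder_plaqFun_eq_zdPlaquetteObs p)
  rw [hfun] at key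
  have hsum : ∑ _e : ↥(plaquetteEdges p), ((Real.sqrt N)⁻¹) ^ 2 ≤ 4 / N := by
    rw [sum_const, card_univ, Fintype.card_coe, nsmul_eq_mul, inv_pow, Real.sq_sqrt hN0.le]
    have h4 : ((plaquetteEdges p).card : ℝ) ≤ 4 := by exact_mod_cast card_plaquetteEdges_le p
    rw [div_eq_mul_inv]
    exact mul_le_mul_of_nonneg_right h4 (inv_nonneg.2 hN0.le)
  exact key.trans (mul_le_mul_of_nonneg_left hsum (inv_nonneg.2 (mul_pos (by linarith) hK₀).le))

/-- ★ **EVERY `SU(N)`, `N ≥ 2`, `d = 4`, HYPOTHESIS-FREE on 't Hooft `0 ≤ b < 1/48`** (bare `Nb`, Bakry–Émery one-link modulus): for every DLR state `μ` and every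
plaquette, `Var_μ(W_p) ≤ 4/(N²(1/2 − 24b))` — the plaquette concentrates at rate `1/N²` in every Gibbs state, uniformly on the window. [folklore] -/
theorem suN_gibbs_variance_plaquette_le_bakryEmery (hN : 2 ≤ N) {b : ℝ} (hb0 : 0 ≤ b) (hb : b < 1 / 48)
    {μ : Measure (LGConfig 4 (SUN N))} (hμ : μ ∈ ymGibbsMeasures (d := 4) (fundamentalRep (Fin N)) ((N : ℝ) * b)) (p : ZdPlaquette 4) :
    Var[zdPlaquetteObs (d := 4) (fundamentalRep (Fin N)) p.1 p.2.1.1 p.2.1.2; μ] ≤ 4 / ((N : ℝ) ^ 2 * (1 / 2 - 24 * b)) := by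
  have hN0 : (0 : ℝ) < N := by exact_mod_cast (show 0 < N by omega)
  have habs : |b| = b := abs_of_nonneg hb0
  have hden : 0 < 1 / 2 - 6 * b := by linarith
  have hc1 : 18 * b / (1 / 2 - 6 * b) < 1 := by rw [div_lt_one hden]; linarith
  have hK₀ : 0 < (N : ℝ) / 2 - N * |b| * (2 * (((4 : ℕ) : ℝ) - 1)) := by rw [habs]; push_cast; nlinarith
  have key := gibbs_variance_plaquette_le_of_oneLinkKRModulus (d := 4) (N := N) (by norm_num) (by omega) (β := b) (K := 1 / (1 / 2 - 6 * b))
    (by positivity) (R := 6 * b) (by rw [habs]; push_cast; linarith) (Balaban1983to89.StrongCouplingKernelWindow.oneLinkKRModulus_SU hN (by linarith))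
    (c := 18 * b / (1 / 2 - 6 * b)) (by rw [habs]; push_cast; exact le_of_eq (by field_simp; ring)) hc1 hK₀ hμ p
  have e : (1 - 18 * b / (1 / 2 - 6 * b)) * ((N : ℝ) / 2 - N * |b| * (2 * (((4 : ℕ) : ℝ) - 1))) = N * (1 / 2 - 24 * b) := by
    rw [habs]; push_cast
    rw [show (N : ℝ) / 2 - N * b * (2 * (4 - 1)) = N * (1 / 2 - 6 * b) by ring, sub_mul, one_mul, div_mul_eq_mul_div,
      show 18 * b * ((N : ℝ) * (1 / 2 - 6 * b)) = 18 * b * N * (1 / 2 - 6 * b) by ring, mul_div_assoc, div_self hden.ne', mul_one]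
    ring
  rw [e] at key
  refine key.trans (le_of_eq ?_)
  have h24 : (1 : ℝ) / 2 - 24 * b ≠ 0 := by
    have : (0 : ℝ) < 1 / 2 - 24 * b := by linarith
    exact this.ne'
  field_simp

/-- ★ **`SU(2)`, `d = 4`, HYPOTHESIS-FREE on `0 ≤ β_W < 2/9`**: for every DLR state `μ` and every plaquette, `Var_μ(W_p) ≤ 2/((1 − 9β_W/2)(1 − 3β_W))`
(`W_p = (1/2) Re tr U_p`; the oscillation route gives `96/(2 − 9β_W)`). [folklore] -/
theorem su2_gibbs_variance_plaquette_le {βW : ℝ} (h0 : 0 ≤ βW) (h : βW < 2 / 9)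
    {μ : Measure (LGConfig 4 (SUN 2))} (hμ : μ ∈ ymGibbsMeasures (d := 4) (fundamentalRep (Fin 2)) (βW / 2)) (p : ZdPlaquette 4) :
    Var[zdPlaquetteObs (d := 4) (fundamentalRep (Fin 2)) p.1 p.2.1.1 p.2.1.2; μ] ≤ 2 / ((1 - 9 * βW / 2) * (1 - 3 * βW)) := by
  have hβ : ((2 : ℕ) : ℝ) * (βW / 4) = βW / 2 := by push_cast; ring
  have habs : |βW / 4| = βW / 4 := abs_of_nonneg (by positivity)
  have hμ4 : μ ∈ ymGibbsMeasures (d := 4) (fundamentalRep (Fin 2)) (((2 : ℕ) : ℝ) * (βW / 4)) := by rwa [hβ]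
  have key := gibbs_variance_plaquette_le_of_oneLinkKRModulus (d := 4) (N := 2) (by norm_num) (by norm_num) (β := βW / 4) zero_le_one
    (R := 3 * βW / 2) (by rw [habs]; norm_num; linarith) (SlabAreaLawDimensions.su2_oneLinkKRModulus_of_le_one (by linarith))
    (c := 9 * βW / 2) (by rw [habs]; norm_num; linarith) (by linarith) (by rw [habs]; norm_num; linarith) hμ4 p
  have e : (1 - 9 * βW / 2) * (((2 : ℕ) : ℝ) / 2 - (2 : ℕ) * |βW / 4| * (2 * (((4 : ℕ) : ℝ) - 1))) = (1 - 9 * βW / 2) * (1 - 3 * βW) := by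
    rw [habs]; push_cast; ring
  rw [e] at key
  refine key.trans (le_of_eq ?_)
  push_cast
  rw [inv_mul_eq_div]
  congr 1
  norm_num

end Plaquette

end Summit.Ventures.YMGap.RobustBall.LangevinPoincare

end
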